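import Literature.Analysis.OperatorTheory.KnabeGapAmplification

/-!
# Knabe's local-gap amplification on `(ℤ/M)⁴` — the pair counting

Combinatorial half of the squaring argument behind `KnabeWith 2 (fun n => 6000 / (2 * n - 1)) 1`
(Knabe 1988 §2; Gosset–Mozgunov 2016 Thm. 1), for the vocabulary of
`Literature/Analysis/OperatorTheory/KnabeGapAmplification.lean` (`cdist`, patches of sup-radius `n` on `(ℤ/M)⁴`):
symmetry and triangle inequality of the cyclic index distance `cdist`; the ball count `#{x | cdist c x < r} = 2r - 1`
and the box count `#{x | ∀ k, cdist (c k) (x k) < r k} = ∏ (2 r k - 1)`; the pair count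
`N(y,z) = #{x | y, z ∈ patch x} ≥ ∏ₖ (2(n - dₖ) - 1)₊ ≥ (2n-1)⁴ - 2 (2n-1)³ ∑ₖ dₖ` (`dₖ = cdist (y k) (z k)`);
and the near-pair defect sum `∑_{z : all dₖ ≤ 2} ((2n-1)⁴ - N(y,z)) ≤ (2n-1)⁴ · 6000/(2n-1)`, from
`∑_{z near y} ∑ₖ dₖ = 3000`.
The operator half (and the theorem `knabeWith_two`) is in `KnabeGapAmplificationProofs.lean`.
Pair counts are phrased as real sums of patch indicators `(if ∀ k, cdist (y k) (x k) < n then 1 else 0)`, the form in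
which the squaring argument consumes them.

References: S. Knabe, J. Stat. Phys. 52 (1988) 627–638, §2; D. Gosset, E. Mozgunov, J. Math. Phys. 57 (2016) 091901.
-/

open scoped BigOperators

namespace Literature.Analysis.OperatorTheory.KnabeDevice

/-- The cyclic index distance is symmetric: `cdist i j = cdist j i`. [folklore] -/
theorem cdist_comm {M : ℕ} (i j : Fin M) : cdist i j = cdist j i := by
  unfold cdist
  rw [← ZMod.natAbs_valMinAbs_neg, neg_sub]

/-- Triangle inequality for the cyclic index distance: `cdist i l ≤ cdist i j + cdist j l`. [folklore] -/
theorem cdist_triangle {M : ℕ} (i j l : Fin M) : cdist i l ≤ cdist i j + cdist j l := by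
  unfold cdist
  have h : (((i : ℕ) : ZMod M) - ((l : ℕ) : ZMod M))
      = (((i : ℕ) : ZMod M) - ((j : ℕ) : ZMod M)) + ((((j : ℕ) : ZMod M)) - ((l : ℕ) : ZMod M)) := by abel
  rw [h]
  exact (ZMod.natAbs_valMinAbs_add_le _ _).trans (Int.natAbs_add_le _ _)

/-- Ball count on the cycle `ℤ/M`: `#{x | cdist c x < r} = 2r - 1` when `2r ≤ M + 1`
(`ZMod.valMinAbs` is a bijection onto the integer window `(-M/2, M/2]`). [folklore] -/
theorem card_filter_cdist_lt {M : ℕ} [NeZero M] (r : ℕ) (hr : 2 * r ≤ M + 1) (c : Fin M) :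
    (Finset.univ.filter fun x : Fin M => cdist c x < r).card = 2 * r - 1 := by
  have key : (Finset.univ.filter fun x : Fin M => cdist c x < r).card = (Finset.Ioo (-(r : ℤ)) r).card := by
    apply Finset.card_nbij' (fun x : Fin M => (((c : ℕ) : ZMod M) - ((x : ℕ) : ZMod M)).valMinAbs)
      (fun k : ℤ => (⟨(((c : ℕ) : ZMod M) - (k : ZMod M)).val, ZMod.val_lt _⟩ : Fin M))
    · intro x hx
      simp only [Finset.coe_filter, Finset.mem_univ, true_and, Set.mem_setOf_eq] at hx
      simp only [Finset.coe_Ioo, Set.mem_Ioo]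
      unfold cdist at hx
      omega
    · intro k hk
      simp only [Finset.coe_Ioo, Set.mem_Ioo] at hk
      simp only [Finset.coe_filter, Finset.mem_univ, true_and, Set.mem_setOf_eq]
      unfold cdist
      simp only [ZMod.natCast_zmod_val, sub_sub_cancel]
      have hk2 : ((k : ZMod M)).valMinAbs = k := by
        rw [ZMod.valMinAbs_spec]
        refine ⟨rfl, ?_, ?_⟩ <;> omega
      rw [hk2]
      omega
    · intro x _
      ext
      simp only [ZMod.coe_valMinAbs, sub_sub_cancel]
      exact ZMod.val_cast_of_lt x.isLt
    · intro k hk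
      simp only [Finset.coe_Ioo, Set.mem_Ioo] at hk
      simp only [ZMod.natCast_zmod_val, sub_sub_cancel]
      rw [ZMod.valMinAbs_spec]
      refine ⟨rfl, ?_, ?_⟩ <;> omega
  rw [key, Int.card_Ioo]
  omega

/-- Box count on the torus `(ℤ/M)⁴` with per-axis radii: `#{x | ∀ k, cdist (c k) (x k) < r k} = ∏ₖ (2 r k - 1)`
when `2 r k ≤ M + 1` for all `k`. [folklore] -/
theorem card_filter_forall_cdist_lt {M : ℕ} [NeZero M] (r : Fin 4 → ℕ) (hr : ∀ k, 2 * r k ≤ M + 1)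
    (c : Fin 4 → Fin M) :
    (Finset.univ.filter fun x : Fin 4 → Fin M => ∀ k, cdist (c k) (x k) < r k).card = ∏ k, (2 * r k - 1) := by
  have h : (Finset.univ.filter fun x : Fin 4 → Fin M => ∀ k, cdist (c k) (x k) < r k)
      = Fintype.piFinset fun k => Finset.univ.filter fun a : Fin M => cdist (c k) a < r k := by
    ext x
    simp [Fintype.mem_piFinset]
  rw [h, Fintype.card_piFinset]
  exact Finset.prod_congr rfl fun k _ => card_filter_cdist_lt (r k) (hr k) (c k)

/-- Diagonal pair count `N(y,y) = #{x | y ∈ patch x} = (2n-1)⁴`, as a real sum of patch indicators.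
[cite: Knabe1988, §2] -/
theorem sum_patchIndicator_eq {M : ℕ} [NeZero M] (n : ℕ) (hM : 2 * n ≤ M + 1) (y : Fin 4 → Fin M) :
    ∑ x : Fin 4 → Fin M, (if (∀ k, cdist (y k) (x k) < n) then (1 : ℝ) else 0) = ((2 * n - 1 : ℕ) : ℝ) ^ 4 := by
  rw [Finset.sum_boole, card_filter_forall_cdist_lt (fun _ => n) (fun _ => hM) y, Finset.prod_const, Finset.card_univ,
    Fintype.card_fin, Nat.cast_pow]

/-- Near-partner count: `#{z | ∀ k, cdist (y k) (z k) ≤ 2} = 5⁴ = 625` (for `M ≥ 5`). [folklore] -/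
theorem card_filter_near {M : ℕ} [NeZero M] (hM : 6 ≤ M + 1) (y : Fin 4 → Fin M) :
    (Finset.univ.filter fun z : Fin 4 → Fin M => ∀ k, cdist (y k) (z k) ≤ 2).card = 625 := by
  have h : (Finset.univ.filter fun z : Fin 4 → Fin M => ∀ k, cdist (y k) (z k) ≤ 2)
      = Finset.univ.filter fun z : Fin 4 → Fin M => ∀ k, cdist (y k) (z k) < (fun _ => 3) k := by
    ext z
    simp only [Finset.mem_filter, Finset.mem_univ, true_and]
    exact forall_congr' fun k => by omega
  rw [h, card_filter_forall_cdist_lt _ (fun _ => hM) y]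
  decide

/-- Near partners with one axis pinned to radius `r₀ ∈ {1, 2}`:
`#{z | (∀ j, cdist (y j) (z j) ≤ 2) ∧ cdist (y k) (z k) < r₀} = (2r₀ - 1) · 5³` (for `M ≥ 5`). [folklore] -/
theorem card_filter_near_filter_lt {M : ℕ} [NeZero M] (hM : 6 ≤ M + 1) (y : Fin 4 → Fin M) (k : Fin 4)
    (r₀ : ℕ) (hr₀ : r₀ = 1 ∨ r₀ = 2) :
    ((Finset.univ.filter fun z : Fin 4 → Fin M => ∀ j, cdist (y j) (z j) ≤ 2).filter
      fun z => cdist (y k) (z k) < r₀).card = (2 * r₀ - 1) * 125 := by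
  rw [Finset.filter_filter]
  have h : (Finset.univ.filter fun z : Fin 4 → Fin M => (∀ j, cdist (y j) (z j) ≤ 2) ∧ cdist (y k) (z k) < r₀)
      = Finset.univ.filter fun z : Fin 4 → Fin M => ∀ j, cdist (y j) (z j) < (if j = k then r₀ else 3) := by
    ext z
    simp only [Finset.mem_filter, Finset.mem_univ, true_and]
    constructor
    · rintro ⟨h1, h2⟩ j
      split_ifs with hj
      · subst hj; exact h2
      · have := h1 j; omega
    · intro h
      refine ⟨fun j => ?_, by simpa using h k⟩
      have := h j
      split_ifs at this with hj <;> omega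
  rw [h, card_filter_forall_cdist_lt _ (fun j => by split_ifs <;> omega) y]
  rcases hr₀ with rfl | rfl <;> fin_cases k <;> decide

/-- Layer sum over the near partners along one axis: `∑_{z near y} cdist (y k) (z k) ≤ 750`
(`= 125 · (0 + 1 + 1 + 2 + 2)`; for `M ≥ 5`). [folklore] -/
theorem sum_near_cdist_le {M : ℕ} [NeZero M] (hM : 6 ≤ M + 1) (y : Fin 4 → Fin M) (k : Fin 4) :
    ∑ z ∈ Finset.univ.filter (fun z : Fin 4 → Fin M => ∀ j, cdist (y j) (z j) ≤ 2), (cdist (y k) (z k) : ℝ)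
      ≤ 750 := by
  have h1 : ∀ z ∈ Finset.univ.filter (fun z : Fin 4 → Fin M => ∀ j, cdist (y j) (z j) ≤ 2), (cdist (y k) (z k) : ℝ)
      ≤ (if ¬ cdist (y k) (z k) < 1 then 1 else 0) + (if ¬ cdist (y k) (z k) < 2 then 1 else 0) := by
    intro z hz
    simp only [Finset.mem_filter, Finset.mem_univ, true_and] at hz
    have hk := hz k
    interval_cases h : cdist (y k) (z k) <;> norm_num
  have h2 : ∀ r₀, r₀ = 1 ∨ r₀ = 2 →
      (((Finset.univ.filter fun z : Fin 4 → Fin M => ∀ j, cdist (y j) (z j) ≤ 2).filter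
        fun z => ¬ cdist (y k) (z k) < r₀).card : ℝ) = 625 - (2 * r₀ - 1) * 125 := by
    intro r₀ hr₀
    have hc := Finset.card_filter_add_card_filter_not (s := Finset.univ.filter fun z : Fin 4 → Fin M =>
      ∀ j, cdist (y j) (z j) ≤ 2) (fun z => cdist (y k) (z k) < r₀)
    rw [card_filter_near_filter_lt hM y k r₀ hr₀, card_filter_near hM y] at hc
    have h3 : ((Finset.univ.filter fun z : Fin 4 → Fin M => ∀ j, cdist (y j) (z j) ≤ 2).filter
        fun z => ¬ cdist (y k) (z k) < r₀).card = 625 - (2 * r₀ - 1) * 125 := by omega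
    rw [h3]
    rcases hr₀ with rfl | rfl <;> norm_num
  refine (Finset.sum_le_sum h1).trans ?_
  rw [Finset.sum_add_distrib, Finset.sum_boole, Finset.sum_boole, h2 1 (Or.inl rfl), h2 2 (Or.inr rfl)]
  norm_num

/-- The first-order product estimate on four factors: `L⁴ - L³ ∑ₖ (L - aₖ) ≤ ∏ₖ aₖ` for `0 ≤ aₖ ≤ L`. [folklore] -/
theorem pow_four_sub_le_prod (L : ℝ) (a : Fin 4 → ℝ) (h0 : ∀ k, 0 ≤ a k) (hL : ∀ k, a k ≤ L) :
    L ^ 4 - L ^ 3 * ∑ k, (L - a k) ≤ ∏ k, a k := by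
  simp only [Fin.prod_univ_four, Fin.sum_univ_four]
  have hL0 : 0 ≤ L := (h0 0).trans (hL 0)
  have e0 := sub_nonneg.mpr (hL 0)
  have e1 := sub_nonneg.mpr (hL 1)
  have e2 := sub_nonneg.mpr (hL 2)
  have e3 := sub_nonneg.mpr (hL 3)
  nlinarith [mul_nonneg (mul_nonneg e0 e1) (mul_nonneg hL0 hL0), mul_nonneg (mul_nonneg (mul_nonneg hL0 e0) e2) hL0,
    mul_nonneg (mul_nonneg (mul_nonneg (h0 0) e1) e2) hL0, mul_nonneg (mul_nonneg (mul_nonneg hL0 hL0) e0) e3,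
    mul_nonneg (mul_nonneg (mul_nonneg hL0 (h0 0)) e1) e3, mul_nonneg (mul_nonneg (mul_nonneg (h0 0) (h0 1)) e2) e3]

/-- Lower pair count: `N(y,z) ≥ ∏ₖ (2(n - dₖ) - 1)₊` with `dₖ = cdist (y k) (z k)`, since the box with radii `n - dₖ`
around `y` lies in both patches (triangle inequality); `N(y,z)` as a real sum of products of patch indicators.
[cite: Knabe1988, §2] -/
theorem prod_le_sum_patchIndicator_mul {M : ℕ} [NeZero M] (n : ℕ) (hM : 2 * n ≤ M + 1) (y z : Fin 4 → Fin M) :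
    ∏ k, ((2 * (n - cdist (y k) (z k)) - 1 : ℕ) : ℝ) ≤ ∑ x : Fin 4 → Fin M, (if (∀ k, cdist (y k) (x k) < n)
      then (1 : ℝ) else 0) * (if (∀ k, cdist (z k) (x k) < n) then (1 : ℝ) else 0) := by
  have h1 : ∏ k, ((2 * (n - cdist (y k) (z k)) - 1 : ℕ) : ℝ)
      = ∑ x : Fin 4 → Fin M, (if (∀ k, cdist (y k) (x k) < n - cdist (y k) (z k)) then (1 : ℝ) else 0) := by
    rw [Finset.sum_boole, card_filter_forall_cdist_lt (fun k => n - cdist (y k) (z k)) (fun k => by omega) y]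
    push_cast
    rfl
  rw [h1]
  refine Finset.sum_le_sum fun x _ => ?_
  by_cases hx : ∀ k, cdist (y k) (x k) < n - cdist (y k) (z k)
  · have hy : ∀ k, cdist (y k) (x k) < n := fun k => by have := hx k; omega
    have hz : ∀ k, cdist (z k) (x k) < n := fun k => by
      have h1 := hx k
      have h3 := cdist_triangle (z k) (y k) (x k)
      have h4 := cdist_comm (y k) (z k)
      omega
    rw [if_pos hx, if_pos hy, if_pos hz]
    norm_num
  · rw [if_neg hx]
    exact mul_nonneg (by split_ifs <;> norm_num) (by split_ifs <;> norm_num)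

/-- First-order defect bound for a pair: `(2n-1)⁴ - N(y,z) ≤ 2 (2n-1)³ ∑ₖ cdist (y k) (z k)`.
[cite: Knabe1988, §2] -/
theorem patchDefect_le {M : ℕ} [NeZero M] (n : ℕ) (hn : 1 ≤ n) (hM : 2 * n ≤ M + 1) (y z : Fin 4 → Fin M) :
    ((2 * n - 1 : ℕ) : ℝ) ^ 4 - ∑ x : Fin 4 → Fin M, (if (∀ k, cdist (y k) (x k) < n) then (1 : ℝ) else 0)
        * (if (∀ k, cdist (z k) (x k) < n) then (1 : ℝ) else 0)
      ≤ 2 * ((2 * n - 1 : ℕ) : ℝ) ^ 3 * ∑ k, (cdist (y k) (z k) : ℝ) := by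
  have hprod := pow_four_sub_le_prod ((2 * n - 1 : ℕ) : ℝ) (fun k => ((2 * (n - cdist (y k) (z k)) - 1 : ℕ) : ℝ))
    (fun k => Nat.cast_nonneg _) (fun k => by exact_mod_cast (by omega : 2 * (n - cdist (y k) (z k)) - 1 ≤ 2 * n - 1))
  have hsum : ∑ k, (((2 * n - 1 : ℕ) : ℝ) - ((2 * (n - cdist (y k) (z k)) - 1 : ℕ) : ℝ))
      ≤ ∑ k, 2 * (cdist (y k) (z k) : ℝ) := Finset.sum_le_sum fun k _ => by
    have : (2 * n - 1 : ℕ) ≤ (2 * (n - cdist (y k) (z k)) - 1 : ℕ) + 2 * cdist (y k) (z k) := by omega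
    have : ((2 * n - 1 : ℕ) : ℝ) ≤ ((2 * (n - cdist (y k) (z k)) - 1 : ℕ) : ℝ) + 2 * (cdist (y k) (z k) : ℝ) := by
      exact_mod_cast this
    linarith
  have hL0 : (0 : ℝ) ≤ ((2 * n - 1 : ℕ) : ℝ) ^ 3 := by positivity
  have := prod_le_sum_patchIndicator_mul n hM y z
  rw [← Finset.mul_sum] at hsum
  nlinarith [mul_le_mul_of_nonneg_left hsum hL0]

/-- Near-pair defect sum (the counting input of the squaring argument, radius `2`):
`∑_{z : ∀ k, cdist (y k) (z k) ≤ 2} ((2n-1)⁴ - N(y,z)) ≤ (2n-1)⁴ · 6000/(2n-1)` for `n ≥ 1`, `4(n+2) ≤ M`.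
[cite: Knabe1988, §2] -/
theorem sum_near_patchDefect_le {M : ℕ} [NeZero M] (n : ℕ) (hn : 1 ≤ n) (hM : 4 * (n + 2) ≤ M)
    (y : Fin 4 → Fin M) :
    ∑ z ∈ Finset.univ.filter (fun z : Fin 4 → Fin M => ∀ k, cdist (y k) (z k) ≤ 2),
      (((2 * n - 1 : ℕ) : ℝ) ^ 4 - ∑ x : Fin 4 → Fin M, (if (∀ k, cdist (y k) (x k) < n) then (1 : ℝ) else 0)
          * (if (∀ k, cdist (z k) (x k) < n) then (1 : ℝ) else 0))
      ≤ ((2 * n - 1 : ℕ) : ℝ) ^ 4 * (6000 / (2 * n - 1)) := by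
  have hL : ((2 * n - 1 : ℕ) : ℝ) = 2 * n - 1 := by
    rw [Nat.cast_sub (by omega : 1 ≤ 2 * n)]
    push_cast
    ring
  have hL0 : (0 : ℝ) < ((2 * n - 1 : ℕ) : ℝ) := by exact_mod_cast (by omega : 0 < 2 * n - 1)
  refine (Finset.sum_le_sum fun z _ => patchDefect_le n hn (by omega) y z).trans ?_
  rw [← Finset.mul_sum, Finset.sum_comm]
  have h4 : ∑ k : Fin 4, ∑ z ∈ Finset.univ.filter (fun z : Fin 4 → Fin M => ∀ j, cdist (y j) (z j) ≤ 2),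
      (cdist (y k) (z k) : ℝ) ≤ 4 * 750 :=
    (Finset.sum_le_card_nsmul _ _ _ fun k _ => sum_near_cdist_le (by omega) y k).trans (by simp)
  rw [← hL]
  have e : ((2 * n - 1 : ℕ) : ℝ) ^ 4 * (6000 / ((2 * n - 1 : ℕ) : ℝ)) = 6000 * ((2 * n - 1 : ℕ) : ℝ) ^ 3 := by
    rw [mul_div_assoc', div_eq_iff hL0.ne']
    ring
  rw [e]
  nlinarith [mul_le_mul_of_nonneg_left h4 (pow_pos hL0 3).le]

end Literature.Analysis.OperatorTheory.KnabeDevice
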